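import Literature.Geometry.Kaehler.ComplexTorusPrimitiveHodgeLatticeDefinite
import HarnessLib

/-!
# One Lefschetz step on the integral Hodge lattices of a polarised abelian variety

[topic Geometry/Kaehler] For a polarised abelian variety `X = E/Λ` of dimension `g = j + 2` with Riemann form `η` of type
`(d₁, …, d_g)` (`θ = η_ℂ`, `γ_q` the content-normalised class `q!·d₁⋯d_q·γ_q = θ^{∧q}`, `B_k(x, y) = ⟨x, γ ∧ y⟩_e` the integral
Lefschetz forms of the tree, `sign = orientationSign Φ e`), this file compares the integral Hodge lattices
`Hdgᵖ(X, ℤ) = H^{2p}(X, ℤ) ∩ H^{p,p}` and `Hdg^{p+1}(X, ℤ)` along the Lefschetz map `x ↦ x ∧ θ` — ON THE LATTICES, i.e. for the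
indices of inertia `b^±` over `ℤ` (Serre) rather than for real/rational signatures.

## Main results

* `IsPolarizationType.exists_nsmul_eq_primitive_add_wedge_ofRealForm` (§1): the Lefschetz decomposition of an INTEGRAL Hodge class up
  to a positive multiple, `N·x = y₀ + β ∧ θ` with `y₀` primitive integral of type `(p+1, p+1)` and `β` integral of type `(p, p)`
  (Voisin Rem. 6.27 / Lange §7.3.2 (3) with denominators cleared).
* `IsPolarizationType.integralHodge_lattice_lefschetz_step` (§2, abstract sublattices `M = Hdg^{p+1}(X, ℤ)`, `M' = Hdgᵖ(X, ℤ)` given by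
  membership predicates) and `IsPolarizationType.integralHodgeClassesIn_lattice_lefschetz_step` (§3, the concrete `ℤ`-submodules):
  IF `B_{2p}|_{Hdgᵖ(X, ℤ)}` is non-degenerate THEN `B_{2p+2}|_{Hdg^{p+1}(X, ℤ)}` is non-degenerate,
  `rk Hdg^{p+1}(X, ℤ) = rk Hdgᵖ(X, ℤ) + rk Hdg^{p+1}(X, ℤ)_prim`, and
  `(b⁺, b⁻)(s·B_{2p+2}|_{Hdg^{p+1}(X, ℤ)}) = (b⁺, b⁻)(s·B_{2p}|_{Hdgᵖ(X, ℤ)}) + (rk Hdg^{p+1}(X, ℤ)_prim, 0)` (`p + 1` even) resp.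
  `+ (0, rk Hdg^{p+1}(X, ℤ)_prim)` (`p + 1` odd), `s = sign·(−1)^q`, `2p + 2 + q = g`. Ingredients: the sublattice `Hdgᵖ(X, ℤ) ∧ θ` of
  `Hdg^{p+1}(X, ℤ)` carries `c·B_{2p}|_{Hdgᵖ(X, ℤ)}` (`c = (q+1)(q+2)d_{q+1}d_{q+2}`), its orthogonal inside `Hdg^{p+1}(X, ℤ)` is EXACTLY the
  primitive part (§1), the sum has finite index (Kitaoka), and Hodge–Riemann over `ℤ` (`ComplexTorusPrimitiveHodgeLatticeDefinite`)
  makes `s·B_{2p+2}` definite of sign `(−1)^{p+1}` on the primitive part; indices add over orthogonal sums of finite index (Serre).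
* `IsPolarizationType.hodgeIndex_integralHodgeClassesIn_two_one` (§3, the step `Hdg⁰ → Hdg¹`): **the Hodge index theorem on the lattice
  `Hdg¹(X, ℤ)`**: `B₂|_{Hdg¹(X, ℤ)}` is non-degenerate, `rk Hdg¹(X, ℤ) = 1 + rk Hdg¹(X, ℤ)_prim` and
  `(b⁺, b⁻)(sign·(−1)^{g−2}·B₂|_{Hdg¹(X, ℤ)}) = (1, ρ − 1)` (Hartshorne V Rem. 1.9.1 read on the integral `(1,1)`-classes; degree `0`:
  `(b⁺, b⁻)(s·B₀) = (1, 0)`, `IsPolarizationType.sigPos_sigNeg_smul_of_eq_poincarePairing_wedge_degree_zero`).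
* `IsPolarizationType.sigPos_sigNeg_integralHodgeClassesIn_four_two` (§3, the step `Hdg¹ → Hdg²`, `g ≥ 4`):
  `(b⁺, b⁻)(s·B₄|_{Hdg²(X, ℤ)}) = (1 + rk Hdg²(X, ℤ)_prim, ρ − 1)`; for an abelian fourfold `B₄` is the intersection form on `H⁴(X, ℤ)`.
* Lattice helpers: `nondegenerate_of_nondegenerate_restrict_orthogonal_of_det_ne_zero` (a torsion-free lattice is non-degenerate as
  soon as `L ⊕ L^⊥` has finite index with both restrictions non-degenerate), `nondegenerate_restrict_of_forall_mem`,
  `sigPos_sigNeg_restrict_of_forall_mem`, `lefschetzPow_one_eq_wedge_ofRealForm`, `mem_toIntSubmodule_integralHodgeClassesIn_iff`,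
  `evenPieceIdx_zero`, `oddPieceIdx_zero`.

## References

* [cite: VoisinHodgeI2002, §6.2.3 Lemma 6.26, Rem. 6.27; §6.3.2 Lemma 6.31, Thm. 6.32, Thm. 6.33 (PDF pp. 128–129); §7.1.2 (PDF p. 134)]
* [cite: Lange2023AbelianVarietiesComplex, §5.4.1 Thm. 5.4.2 and (5.22) (PDF p. 275); §5.1.2 (p. 244); §7.2.2; §7.3.2 (3); §1.1.3 Exercise 1.1.6 (8)]
* [cite: Kitaoka1993, Ch. 5 Prop. 5.3.3 (proof)]
* [cite: Serre1973, Ch. V §1.3.2 and §1.3.7]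
* [cite: Huybrechts2016K3, Ch. 14 §0.1]
* [cite: Hartshorne1977, Ch. V Thm. 1.9, Rem. 1.9.1]
* [cite: MilnorHusemoller1973, Ch. II §2]
* [cite: Warner1983, 2.6]
-/

noncomputable section

-- `Module ℂ` / `SMulZeroClass ℂ` synthesis on `E [⋀^Fin k]→L[ℝ] ℂ` (as in `ComplexTorusLefschetzDecomposition`)
set_option maxSynthPendingDepth 3

open Module Function
open LinearMap (BilinForm)
open Literature.LinearAlgebra.Alternating
open Literature.Analysis.Complex (IsOfTypeAt typeSubmodule)

namespace Literature.Geometry.Kaehler.ComplexTorus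

/-! ## §0 Helpers -/

section Helpers

variable {E : Type*} [NormedAddCommGroup E] [NormedSpace ℂ E] {m : ℕ}

/-- `L¹ β = β ∧ θ`: the bundled Lefschetz operator `lefschetzPow η 1` into degree `m + 2` is `β ↦ β ∧ θ` (`θ = η_ℂ`; `1 ∧ θ = θ`,
graded commutativity for the even form `θ`). [cite: Lange2023AbelianVarietiesComplex, §7.3.2] [cite: Warner1983, 2.6] -/
theorem lefschetzPow_one_eq_wedge_ofRealForm (η : E [⋀^Fin 2]→L[ℝ] ℝ) (h : 2 * 1 + m = m + 2) (β : E [⋀^Fin m]→L[ℝ] ℂ) :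
    lefschetzPow η 1 h β = β.wedge (ofRealForm η : E [⋀^Fin 2]→L[ℝ] ℂ) := by
  have hc : (ofRealForm η : E [⋀^Fin 2]→L[ℝ] ℂ).wedge β =
      (β.wedge (ofRealForm η : E [⋀^Fin 2]→L[ℝ] ℂ)).domDomCongr (finCongr (Nat.add_comm m 2)) := by
    have hs : ((-1 : ℝ) ^ (m * 2)) = 1 := by rw [mul_comm, pow_mul, neg_one_sq, one_pow]
    rw [ContinuousAlternatingMap.WedgeComm_holds ℝ E ℂ β (ofRealForm η : E [⋀^Fin 2]→L[ℝ] ℂ), hs, one_smul]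
  rw [lefschetzPow_apply, wedgePow_one]
  change (((ContinuousAlternatingMap.constOfIsEmpty ℝ E (Fin 0) (1 : ℂ)).wedge (ofRealForm η : E [⋀^Fin 2]→L[ℝ] ℂ)).wedge β).domDomCongr _ = _
  rw [ContinuousAlternatingMap.constOfIsEmpty_one_wedge, domDomCongr_finCongr_wedge, domDomCongr_finCongr_trans, hc,
    domDomCongr_finCongr_trans, domDomCongr_finCongr_self]

variable {M : Type*} [AddCommGroup M]

/-- **A lattice is non-degenerate as soon as `L ⊕ L^⊥` is of finite index with `B|_L` and `B|_{L^⊥}` non-degenerate** (torsion-free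
`M`, `B` symmetric, `det G_L ≠ 0`): if `B(x, ·) = 0` then `n·x = l + w ∈ L ⊕ L^⊥` (`n = [M : L ⊕ L^⊥] ≠ 0`, Kitaoka) has `l = 0` and
`w = 0`. [cite: Kitaoka1993, Ch. 5 Prop. 5.3.3 (proof)] [cite: Huybrechts2016K3, Ch. 14 §0.1] -/
theorem nondegenerate_of_nondegenerate_restrict_orthogonal_of_det_ne_zero [IsAddTorsionFree M] (B : BilinForm ℤ M)
    (hB : B.IsSymm) (L : Submodule ℤ M) {κ : Type*} [Fintype κ] [DecidableEq κ] (bL : Basis κ ℤ L)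
    (hdet : (LinearMap.BilinForm.toMatrix bL (B.restrict L)).det ≠ 0) (hN : (B.restrict (B.orthogonal L)).Nondegenerate) :
    B.Nondegenerate := by
  have hidx := Literature.Topology.FourManifolds.index_sup_orthogonal_ne_zero B L hB bL hdet
  have hLn := LinearMap.BilinForm.nondegenerate_of_det_ne_zero _ bL hdet
  refine (LinearMap.IsRefl.nondegenerate_iff_separatingLeft (LinearMap.BilinForm.IsSymm.isRefl hB)).2 fun x hx ↦ ?_
  -- `n • x ∈ L ⊔ L^⊥`
  have hmem : ((L ⊔ B.orthogonal L).toAddSubgroup.index : ℤ) • x ∈ L ⊔ B.orthogonal L := by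
    rw [Nat.cast_smul_eq_nsmul]
    exact (L ⊔ B.orthogonal L).toAddSubgroup.nsmul_index_mem x
  obtain ⟨l, hl, w, hw, hlw⟩ := Submodule.mem_sup.1 hmem
  -- `l = 0`: `B(l, y) = B(n x, y) − B(w, y) = 0` for `y ∈ L`
  have hl0 : l = 0 := by
    have h : (⟨l, hl⟩ : L) = 0 := hLn.1 ⟨l, hl⟩ fun y ↦ by
      rw [LinearMap.BilinForm.restrict_apply]
      have h1 : B (((L ⊔ B.orthogonal L).toAddSubgroup.index : ℤ) • x) (y : M) = 0 := by
        rw [LinearMap.BilinForm.smul_left, hx, mul_zero]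
      have h2 : B w (y : M) = 0 := by rw [hB.eq]; exact (LinearMap.BilinForm.mem_orthogonal_iff.1 hw) _ y.2
      rw [← hlw, map_add, LinearMap.add_apply, h2, add_zero] at h1
      exact h1
    exact congrArg Subtype.val h
  -- `w = 0`: `B(w, w') = B(n x, w') = 0` for `w' ∈ L^⊥`
  have hw0 : w = 0 := by
    have h : (⟨w, hw⟩ : ↥(B.orthogonal L)) = 0 := hN.1 ⟨w, hw⟩ fun w' ↦ by
      rw [LinearMap.BilinForm.restrict_apply]
      have h1 : B (((L ⊔ B.orthogonal L).toAddSubgroup.index : ℤ) • x) (w' : M) = 0 := by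
        rw [LinearMap.BilinForm.smul_left, hx, mul_zero]
      rw [← hlw, hl0, zero_add] at h1
      exact h1
    exact congrArg Subtype.val h
  rw [hl0, hw0, add_zero] at hlw
  exact (smul_eq_zero.1 hlw.symm).resolve_left (Int.natCast_ne_zero.2 hidx)

end Helpers

/-! ## §1 The Lefschetz decomposition of an INTEGRAL Hodge class, up to a positive multiple -/

section Decomposition

variable {ι : Type*} [Fintype ι] [DecidableEq ι] {E : Type*} [NormedAddCommGroup E] [NormedSpace ℂ E]
  {Φ : (ι → ℝ) ≃L[ℝ] E} {j p q : ℕ} {η : E [⋀^Fin 2]→L[ℝ] ℝ} {d : Fin (j + 2) → ℕ}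

omit [DecidableEq ι] in
/-- **Integral Lefschetz decomposition of integral Hodge classes, up to a multiple.** For a polarised abelian variety of
dimension `g = j + 2 = (2p + 2) + q` and an integral Hodge class `x ∈ H^{2p+2}(X, ℤ) ∩ H^{p+1,p+1}` there are `N > 0`, a PRIMITIVE
integral Hodge class `y₀ ∈ H^{2p+2}(X, ℤ) ∩ H^{p+1,p+1}` (`θ^{∧(q+1)} ∧ y₀ = 0`) and an integral Hodge class `β ∈ H^{2p}(X, ℤ) ∩ H^{p,p}` with
**`N·x = y₀ + β ∧ θ`** — the rational Lefschetz decomposition of Hodge classes `Bᵖ⁺¹(X) = Bᵖ⁺¹(X)_prim ⊕ L Bᵖ(X)` (Voisin: `L` has bidegree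
`(1, 1)` and the primitive components of a Hodge class are Hodge classes; the tree's `exists_primitive_hodgeClass_add_lefschetzPow`) with
denominators cleared (`Bᵖ(X) = Hdgᵖ(X, ℤ) ⊗ ℚ`). [cite: VoisinHodgeI2002, §6.2.3 Rem. 6.27; §7.1.2 (PDF p. 134 L31)] [cite: Lange2023AbelianVarietiesComplex, §7.3.2 (3); §7.2.2] -/
theorem IsPolarizationType.exists_nsmul_eq_primitive_add_wedge_ofRealForm (hd : IsPolarizationType Φ η d) (hη : IsRiemannForm Φ η)
    (hpq : 2 * p + 2 + q = j + 2) {x : E [⋀^Fin (2 * p + 2)]→L[ℝ] ℂ} (hx : x ∈ integralHodgeClassesIn Φ (2 * p + 2) (p + 1)) :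
    ∃ N : ℕ, 0 < N ∧ ∃ y₀ ∈ integralHodgeClassesIn Φ (2 * p + 2) (p + 1),
      (wedgePow (ofRealForm η) (q + 1)).wedge y₀ = 0 ∧
      ∃ β ∈ integralHodgeClassesIn Φ (2 * p) p, (N : ℂ) • x = y₀ + β.wedge (ofRealForm η : E [⋀^Fin 2]→L[ℝ] ℂ) := by
  classical
  haveI : FiniteDimensional ℝ E := Module.Finite.equiv Φ.toLinearEquiv
  haveI : FiniteDimensional ℂ E := Module.Finite.of_restrictScalars_finite ℝ ℂ E
  have hE : finrank ℝ E = Fintype.card ι := by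
    rw [← Φ.toLinearEquiv.finrank_eq, Module.finrank_fintype_fun_eq_card]
  have hg : finrank ℂ E = j + 2 := by
    have h := finrank_real_of_complex E
    rw [hE, hd.card_eq] at h
    omega
  have hp2 : 2 * (p + 1) ≤ finrank ℂ E := by omega
  have hnd : ∀ v : E, v ≠ 0 → ∃ w : E, η ![v, w] ≠ 0 := fun v hv ↦ by
    by_contra h
    push Not at h
    exact hv (hη.nondegenerate v h)
  have hθZ : (ofRealForm η : E [⋀^Fin 2]→L[ℝ] ℂ) ∈ integralForms Φ 2 := ofRealForm_mem_integralForms_two Φ hη.isNSForm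
  have hxH : x ∈ hodgeClasses Φ (p + 1) := integralHodgeClassesIn_subset_hodgeClassesIn Φ (2 * p + 2) (p + 1) hx
  obtain ⟨γ₀, β, hγ₀P, hγ₀H, hβH, hdec⟩ := exists_primitive_hodgeClass_add_lefschetzPow Φ hη.isNSForm hnd hp2 hxH
  have hdec' : x = γ₀ + β.wedge (ofRealForm η : E [⋀^Fin 2]→L[ℝ] ℂ) := by
    rw [← lefschetzPow_one_eq_wedge_ofRealForm η (show 2 * 1 + 2 * p = 2 * p + 2 by omega) β]
    exact hdec
  -- re-type the primitive component in degree `2p + 2` (syntactically), then clear denominators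
  obtain ⟨γ₁, hγ₁⟩ : ∃ γ₁ : E [⋀^Fin (2 * p + 2)]→L[ℝ] ℂ, γ₀ = γ₁ := ⟨γ₀, rfl⟩
  have hγ₁P : (wedgePow (ofRealForm η) (q + 1)).wedge γ₁ = 0 := by
    rw [← hγ₁]
    exact (hd.mem_primitiveForms_iff_wedgePow_wedge_eq_zero hpq γ₀).1 hγ₀P
  rw [hγ₁] at hdec'
  letI : LinearOrder ι := LinearOrder.lift' (Fintype.equivFin ι) (Fintype.equivFin ι).injective
  obtain ⟨N, hN, hNβ⟩ := exists_nsmul_mem_integralHodgeClassesIn Φ hβH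
  have hγ₀eq : (N : ℂ) • γ₁ = (N : ℂ) • x - ((N : ℂ) • β).wedge (ofRealForm η : E [⋀^Fin 2]→L[ℝ] ℂ) := by
    rw [hdec', smul_add, wedge_smul_left_complex, add_sub_cancel_right]
  -- the type of `(N·β) ∧ θ` is `(p+1, p+1)`
  have hβθT : IsOfTypeAt (p + 1) (p + 1) (((N : ℂ) • β).wedge (ofRealForm η : E [⋀^Fin 2]→L[ℝ] ℂ)) :=
    ((Literature.Analysis.Complex.mem_typeSubmodule_iff_isOfTypeAt (show p + p = 2 * p by omega)).1 hNβ.2).wedge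
      (isOfTypeAt_one_one_ofRealForm hη.1)
  have hβθ : ((N : ℂ) • β).wedge (ofRealForm η : E [⋀^Fin 2]→L[ℝ] ℂ) ∈ integralHodgeClassesIn Φ (2 * p + 2) (p + 1) :=
    ⟨wedge_mem_integralForms Φ hNβ.1 hθZ,
      (Literature.Analysis.Complex.mem_typeSubmodule_iff_isOfTypeAt (show p + 1 + (p + 1) = 2 * p + 2 by omega)).2 hβθT⟩
  have hNx : (N : ℂ) • x ∈ integralHodgeClassesIn Φ (2 * p + 2) (p + 1) := by
    rw [Nat.cast_smul_eq_nsmul ℂ N x]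
    exact AddSubgroup.nsmul_mem _ hx N
  refine ⟨N, hN, (N : ℂ) • γ₁, ?_, ?_, (N : ℂ) • β, hNβ, ?_⟩
  · rw [hγ₀eq]
    exact AddSubgroup.sub_mem _ hNx hβθ
  · rw [Literature.NumberTheory.Transcendental.wedge_smul_right_complex, hγ₁P, smul_zero]
  · rw [hdec', smul_add, wedge_smul_left_complex]

end Decomposition

/-! ## §2 One Lefschetz step on the integral Hodge lattices: `Hdg^{p+1}(X, ℤ) ⊇ Hdgᵖ(X, ℤ) ∧ θ ⊕ Hdg^{p+1}(X, ℤ)_prim` -/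

section Step

variable {ι : Type*} [Fintype ι] [DecidableEq ι] {E : Type*} [NormedAddCommGroup E] [NormedSpace ℂ E]
  {Φ : (ι → ℝ) ≃L[ℝ] E} {j n p q : ℕ} {η : E [⋀^Fin 2]→L[ℝ] ℝ} {d : Fin (j + 2) → ℕ}

omit [Fintype ι] in
/-- `sign·(−1)^{q+2} = sign·(−1)^q`. [folklore] -/
private theorem orientationSign_mul_neg_one_pow_add_two₇₂ (Φ : (ι → ℝ) ≃L[ℝ] E) (e : Fin n ≃ ι) (q : ℕ) :
    orientationSign Φ e * (-1) ^ (q + 1 + 1) = orientationSign Φ e * (-1) ^ q := by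
  ring

/-- Isometric lattice forms have the same indices of inertia. [cite: Serre1973, Ch. V §1.3.2] -/
private theorem sigPos_sigNeg_eq_of_equivalent₇₂ {M₁ : Type*} [AddCommGroup M₁] [Module ℤ M₁] {M₂ : Type*}
    [AddCommGroup M₂] [Module ℤ M₂] {Q : BilinForm ℤ M₁} {Q' : BilinForm ℤ M₂} (h : Q.Equivalent Q') :
    sigPos Q.toQuadraticMap = sigPos Q'.toQuadraticMap ∧ sigNeg Q.toQuadraticMap = sigNeg Q'.toQuadraticMap := by
  obtain ⟨f⟩ := h
  have hq : Q.toQuadraticMap.Equivalent Q'.toQuadraticMap :=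
    ⟨{ f.toLinearEquiv with map_app' := fun x ↦ by simp }⟩
  exact ⟨hq.sigPos_eq, hq.sigNeg_eq⟩

/-- **Lattice algebra of one Lefschetz step** (pure lattice statement): `Q` a symmetric form on a lattice `M₀`, `L₂ ⊆ M₀` a sublattice whose
Gram matrix in a basis `b_{L₂}` is `c · G'` (`c > 0`, `G'` the Gram matrix of a form `Q'` on another lattice, `det G' ≠ 0`), and `Q|_{L₂^⊥}`
non-degenerate. Then `Q` is non-degenerate, `rk M₀ = rk L₂ + rk L₂^⊥`, and `b^±(s·Q) = b^±(s·Q') + b^±((s·Q)|_{L₂^⊥})` (`s ≠ 0`):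
Kitaoka's finite index `[M₀ : L₂ ⊥ L₂^⊥] ∣ det G_{L₂}`, additivity of the indices over an orthogonal sum of finite index, and
`(s·Q)|_{L₂} ≅ c·(s·Q')`. [cite: Kitaoka1993, Ch. 5 Prop. 5.3.3 (proof)] [cite: Serre1973, Ch. V §1.3.2 and §1.3.7] [cite: Huybrechts2016K3, Ch. 14 §0.1] -/
private theorem lattice_lefschetz_step₇₂ {M₀ : Type*} [AddCommGroup M₀] [Module.Finite ℤ M₀] [Module.Free ℤ M₀] (Q : BilinForm ℤ M₀)
    (hQ : Q.IsSymm) (L₂ : Submodule ℤ M₀) {r' : ℕ} (bL₂ : Basis (Fin r') ℤ ↥L₂) {M₂ : Type*} [AddCommGroup M₂]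
    (Q' : BilinForm ℤ M₂) (b' : Basis (Fin r') ℤ M₂) {c : ℤ} (hc : 0 < c)
    (hGram : LinearMap.BilinForm.toMatrix bL₂ (Q.restrict L₂) = c • LinearMap.BilinForm.toMatrix b' Q')
    (hdet' : (LinearMap.BilinForm.toMatrix b' Q').det ≠ 0) {s : ℤ} (hs : s ≠ 0)
    (hNn : (Q.restrict (Q.orthogonal L₂)).Nondegenerate) :
    Q.Nondegenerate ∧ finrank ℤ M₀ = r' + finrank ℤ ↥(Q.orthogonal L₂) ∧
    sigPos (s • Q).toQuadraticMap =
      sigPos (s • Q').toQuadraticMap + sigPos ((s • Q).restrict (Q.orthogonal L₂)).toQuadraticMap ∧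
    sigNeg (s • Q).toQuadraticMap =
      sigNeg (s • Q').toQuadraticMap + sigNeg ((s • Q).restrict (Q.orthogonal L₂)).toQuadraticMap := by
  haveI : IsAddTorsionFree M₀ := Module.isTorsionFree_int_iff_isAddTorsionFree.1 inferInstance
  have hdet : (LinearMap.BilinForm.toMatrix bL₂ (Q.restrict L₂)).det ≠ 0 := by
    rw [hGram, Matrix.det_smul]
    exact mul_ne_zero (pow_ne_zero _ hc.ne') hdet'
  have hMn : Q.Nondegenerate := nondegenerate_of_nondegenerate_restrict_orthogonal_of_det_ne_zero Q hQ L₂ bL₂ hdet hNn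
  -- ranks
  have hL₂n : (Q.restrict L₂).Nondegenerate := (LinearMap.BilinForm.nondegenerate_iff_det_ne_zero bL₂).2 hdet
  have hrank := LinearMap.BilinForm.finrank_add_finrank_orthogonal_of_nondegenerate Q L₂ hQ hL₂n
  rw [finrank_eq_card_basis bL₂, Fintype.card_fin] at hrank
  -- additivity of the indices over `L₂ ⊕ L₂^⊥`
  have hresL : (s • Q).restrict L₂ = s • Q.restrict L₂ := rfl
  have hdet_s : (LinearMap.BilinForm.toMatrix bL₂ ((s • Q).restrict L₂)).det ≠ 0 := by
    rw [hresL, map_smul, Matrix.det_smul]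
    exact mul_ne_zero (pow_ne_zero _ hs) hdet
  have hsum := sigPos_sigNeg_eq_add_restrict_orthogonal_of_det_ne_zero (s • Q)
    (LinearMap.BilinForm.isSymm_smul_of_isSymm _ _ hQ) L₂ bL₂ hdet_s
  rw [orthogonal_smul_eq_of_ne_zero Q hs] at hsum
  -- `(s·Q)|_{L₂} ≅ c · (s·Q')`: same indices as `s·Q'`
  have hGram_s : LinearMap.BilinForm.toMatrix bL₂ ((s • Q).restrict L₂) = c • LinearMap.BilinForm.toMatrix b' (s • Q') := by
    rw [hresL, map_smul, hGram, map_smul, smul_comm]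
  have heqL := LinearMap.BilinForm.equivalent_toBilin'_toMatrix ((s • Q).restrict L₂) bL₂
  rw [hGram_s, map_smul] at heqL
  have heqH := LinearMap.BilinForm.equivalent_toBilin'_toMatrix (s • Q') b'
  have h1 := sigPos_sigNeg_eq_of_equivalent₇₂ heqL
  have h2 := sigPos_sigNeg_eq_of_equivalent₇₂ heqH
  rw [LinearMap.BilinForm.sigPos_smul_of_pos _ hc, LinearMap.BilinForm.sigNeg_smul_of_pos _ hc, ← h2.1, ← h2.2] at h1
  rw [h1.1, h1.2] at hsum
  exact ⟨hMn, hrank.symm, hsum⟩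

/-- `lattice_lefschetz_step₇₂` when `ε·s·Q` is positive definite on `L₂^⊥` (`ε = ±1`): `Q|_{L₂^⊥}` is then non-degenerate, and
`(b⁺, b⁻)(s·Q) = (b⁺, b⁻)(s·Q') + (rk L₂^⊥, 0)` if `ε = 1`, `+ (0, rk L₂^⊥)` if `ε = −1` (stated with names `s' = s`, `nL = rk L₂`,
`nP = rk L₂^⊥` for the quantities, in the form the main theorem consumes).
[cite: Serre1973, Ch. V §1.3.2 and §1.3.7] [cite: Kitaoka1993, Ch. 5 Prop. 5.3.3 (proof)] [cite: MilnorHusemoller1973, Ch. II §2] -/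
private theorem lattice_lefschetz_step_of_sign₇₂ {M₀ : Type*} [AddCommGroup M₀] [Module.Finite ℤ M₀] [Module.Free ℤ M₀]
    (Q : BilinForm ℤ M₀) (hQ : Q.IsSymm) (L₂ : Submodule ℤ M₀) {r' : ℕ} (bL₂ : Basis (Fin r') ℤ ↥L₂) {M₂ : Type*}
    [AddCommGroup M₂] (Q' : BilinForm ℤ M₂) (b' : Basis (Fin r') ℤ M₂) {c : ℤ} (hc : 0 < c)
    (hGram : LinearMap.BilinForm.toMatrix bL₂ (Q.restrict L₂) = c • LinearMap.BilinForm.toMatrix b' Q')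
    (hdet' : (LinearMap.BilinForm.toMatrix b' Q').det ≠ 0) {s s' : ℤ} (hs : s ≠ 0) (hs' : s' = s) {ε : ℤ}
    (hdef : ∀ z : ↥(Q.orthogonal L₂), z ≠ 0 → 0 < ε * (s * Q (z : M₀) (z : M₀))) {nL nP : ℕ} (hnL : r' = nL)
    (hnP : finrank ℤ ↥(Q.orthogonal L₂) = nP) :
    Q.Nondegenerate ∧ finrank ℤ M₀ = nL + nP ∧
    (ε = 1 → sigPos (s • Q).toQuadraticMap = sigPos (s' • Q').toQuadraticMap + nP ∧
      sigNeg (s • Q).toQuadraticMap = sigNeg (s' • Q').toQuadraticMap) ∧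
    (ε = -1 → sigPos (s • Q).toQuadraticMap = sigPos (s' • Q').toQuadraticMap ∧
      sigNeg (s • Q).toQuadraticMap = sigNeg (s' • Q').toQuadraticMap + nP) := by
  obtain rfl := hs'.symm
  subst hnL hnP
  haveI : Module.Finite ℤ ↥(Q.orthogonal L₂) :=
    Module.Finite.of_injective (Q.orthogonal L₂).subtype (Q.orthogonal L₂).injective_subtype
  -- `Q|_{L₂^⊥}` is anisotropic, hence non-degenerate
  have h0 : ∀ z : ↥(Q.orthogonal L₂), Q (z : M₀) (z : M₀) = 0 → z = 0 := fun z hz ↦ by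
    by_contra hz0
    have h := hdef z hz0
    rw [hz, mul_zero, mul_zero] at h
    exact lt_irrefl _ h
  have hNn : (Q.restrict (Q.orthogonal L₂)).Nondegenerate :=
    ⟨fun x hx ↦ h0 x (hx x), fun y hy ↦ h0 y (hy y)⟩
  obtain ⟨hMn, hrk, hP, hN⟩ := lattice_lefschetz_step₇₂ Q hQ L₂ bL₂ Q' b' hc hGram hdet' hs hNn
  refine ⟨hMn, hrk, fun h1 ↦ ?_, fun h1 ↦ ?_⟩
  · have hPD : ((s • Q).restrict (Q.orthogonal L₂)).PosDef := by
      rw [LinearMap.BilinForm.posDef_iff]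
      intro z hz
      have h := hdef z hz
      rw [h1, one_mul] at h
      exact h
    have hsig := sigPos_eq_finrank_and_sigNeg_eq_zero_of_posDef _ hPD
    rw [hsig.1] at hP
    rw [hsig.2, add_zero] at hN
    exact ⟨hP, hN⟩
  · have hND : ((s • Q).restrict (Q.orthogonal L₂)).NegDef := by
      rw [LinearMap.BilinForm.negDef_iff]
      intro z hz
      have h := hdef z hz
      rw [h1, neg_one_mul, neg_pos] at h
      exact h
    have hsig := sigPos_eq_zero_and_sigNeg_eq_finrank_of_negDef _ hND
    rw [hsig.1, add_zero] at hP
    rw [hsig.2] at hN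
    exact ⟨hP, hN⟩

/-- If a sublattice `N₂ ⊆ M` of a sublattice `M ⊆ K` and a sublattice `N ⊆ K` are cut out inside `M`, resp. `K`, by the same predicate, then
`N₂ ≅ N ∩ M`; in particular `rk N₂ = rk (N ∩ M)`. [folklore] -/
private theorem finrank_eq_finrank_inf₇₂ {K : Type*} [AddCommGroup K] {M : Submodule ℤ K} (N₂ : Submodule ℤ ↥M) (N : Submodule ℤ K)
    (P : K → Prop) (h₂ : ∀ z : ↥M, z ∈ N₂ ↔ P (z : K)) (h : ∀ y : K, y ∈ N ↔ P y) :
    finrank ℤ ↥N₂ = finrank ℤ ↥(N ⊓ M) := by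
  let eP : ↥N₂ ≃ₗ[ℤ] ↥(N ⊓ M) :=
    { toFun := fun z ↦ ⟨((z : ↥M) : K), Submodule.mem_inf.2 ⟨(h _).2 ((h₂ _).1 z.2), (z : ↥M).2⟩⟩
      invFun := fun w ↦ ⟨⟨(w : K), (Submodule.mem_inf.1 w.2).2⟩, (h₂ _).2 ((h _).1 (Submodule.mem_inf.1 w.2).1)⟩
      left_inv := fun _ ↦ rfl
      right_inv := fun _ ↦ rfl
      map_add' := fun _ _ ↦ rfl
      map_smul' := fun _ _ ↦ rfl }
  exact eP.finrank_eq

omit [Fintype ι] [DecidableEq ι] in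
/-- The Lefschetz map `T : Hdgᵖ(X, ℤ) → Hdg^{p+1}(X, ℤ)`, `x ↦ x ∧ θ` (`θ` is integral of type `(1, 1)`), as a `ℤ`-linear map between the
integral Hodge lattices. [cite: Lange2023AbelianVarietiesComplex, §5.4.1 (5.22) (PDF p. 275); §7.3.2] [cite: VoisinHodgeI2002, §6.2.3 Lemma 6.26] -/
private theorem exists_lefschetz_map₇₂ (hη : IsRiemannForm Φ η) {M : Submodule ℤ ↥(integralForms Φ (2 * p + 2))}
    (hM : ∀ x : ↥(integralForms Φ (2 * p + 2)), x ∈ M ↔ IsOfTypeAt (p + 1) (p + 1) (x : E [⋀^Fin (2 * p + 2)]→L[ℝ] ℂ))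
    {M' : Submodule ℤ ↥(integralForms Φ (2 * p))}
    (hM' : ∀ x : ↥(integralForms Φ (2 * p)), x ∈ M' ↔ IsOfTypeAt p p (x : E [⋀^Fin (2 * p)]→L[ℝ] ℂ)) :
    ∃ T : ↥M' →ₗ[ℤ] ↥M, ∀ x : ↥M', (((T x : ↥M) : ↥(integralForms Φ (2 * p + 2))) : E [⋀^Fin (2 * p + 2)]→L[ℝ] ℂ) =
      (((x : ↥M') : ↥(integralForms Φ (2 * p))) : E [⋀^Fin (2 * p)]→L[ℝ] ℂ).wedge (ofRealForm η : E [⋀^Fin 2]→L[ℝ] ℂ) := by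
  have hθZ : (ofRealForm η : E [⋀^Fin 2]→L[ℝ] ℂ) ∈ integralForms Φ 2 := ofRealForm_mem_integralForms_two Φ hη.isNSForm
  have hθT : IsOfTypeAt 1 1 (ofRealForm η : E [⋀^Fin 2]→L[ℝ] ℂ) := isOfTypeAt_one_one_ofRealForm hη.1
  let T₀ : ↥(integralForms Φ (2 * p)) →ₗ[ℤ] ↥(integralForms Φ (2 * p + 2)) :=
    (((AddMonoidHom.mk' (fun x : E [⋀^Fin (2 * p)]→L[ℝ] ℂ ↦ (x.wedge (ofRealForm η : E [⋀^Fin 2]→L[ℝ] ℂ) : E [⋀^Fin (2 * p + 2)]→L[ℝ] ℂ))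
      (fun x y ↦ ContinuousAlternatingMap.wedge_add_left x y _)).comp (integralForms Φ (2 * p)).subtype).codRestrict
      (integralForms Φ (2 * p + 2)) fun x ↦ wedge_mem_integralForms Φ x.2 hθZ).toIntLinearMap
  have hT₀M : ∀ x : ↥M', (T₀.comp M'.subtype) x ∈ M := fun x ↦ (hM _).2 (((hM' _).1 x.2).wedge hθT)
  exact ⟨LinearMap.codRestrict M (T₀.comp M'.subtype) hT₀M, fun _ ↦ rfl⟩

/-- `B_{2p+2}(T x, T y) = c · B_{2p}(x, y)` on the integral Hodge lattices (`c = (q+1)(q+2)d_{q+1}d_{q+2}`, g45-#1's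
`⟨x ∧ θ, γ_q ∧ (y ∧ θ)⟩ = c·⟨x, γ_{q+2} ∧ y⟩`). [cite: Lange2023AbelianVarietiesComplex, §5.4.1 (5.22) (PDF p. 275)] -/
private theorem apply_lefschetz_map₇₂ (hd : IsPolarizationType Φ η d) (hη : IsRiemannForm Φ η) (hq : q ≤ j + 2) {γ : E [⋀^Fin (2 * q)]→L[ℝ] ℂ}
    (hγ : wedgePow (ofRealForm η) q = ((q.factorial * ∏ i : Fin q, d (Fin.castLE hq i) : ℕ) : ℂ) • γ)
    (hq2 : q + 1 + 1 ≤ j + 2) {γ' : E [⋀^Fin (2 * (q + 1 + 1))]→L[ℝ] ℂ}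
    (hγ' : wedgePow (ofRealForm η) (q + 1 + 1) =
      (((q + 1 + 1).factorial * ∏ i : Fin (q + 1 + 1), d (Fin.castLE hq2 i) : ℕ) : ℂ) • γ')
    (e : Fin n ≃ ι) (hn : 2 * p + 2 + (2 * q + (2 * p + 2)) = n) (hn₂ : 2 * p + (2 * (q + 1 + 1) + 2 * p) = n)
    {B : BilinForm ℤ ↥(integralForms Φ (2 * p + 2))}
    (hB : ∀ x y : ↥(integralForms Φ (2 * p + 2)),
      ((B x y : ℤ) : ℂ) = poincarePairing Φ e hn (x : E [⋀^Fin (2 * p + 2)]→L[ℝ] ℂ) (γ.wedge (y : E [⋀^Fin (2 * p + 2)]→L[ℝ] ℂ)))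
    {B' : BilinForm ℤ ↥(integralForms Φ (2 * p))}
    (hB' : ∀ x y : ↥(integralForms Φ (2 * p)),
      ((B' x y : ℤ) : ℂ) = poincarePairing Φ e hn₂ (x : E [⋀^Fin (2 * p)]→L[ℝ] ℂ) (γ'.wedge (y : E [⋀^Fin (2 * p)]→L[ℝ] ℂ)))
    {M : Submodule ℤ ↥(integralForms Φ (2 * p + 2))} {M' : Submodule ℤ ↥(integralForms Φ (2 * p))} (T : ↥M' →ₗ[ℤ] ↥M)
    (hT : ∀ x : ↥M', (((T x : ↥M) : ↥(integralForms Φ (2 * p + 2))) : E [⋀^Fin (2 * p + 2)]→L[ℝ] ℂ) =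
      (((x : ↥M') : ↥(integralForms Φ (2 * p))) : E [⋀^Fin (2 * p)]→L[ℝ] ℂ).wedge (ofRealForm η : E [⋀^Fin 2]→L[ℝ] ℂ)) (x y : ↥M') :
    B (T x : ↥M) (T y : ↥M) = (((q + 1) * (q + 2) * d (Fin.castLE hq2 (Fin.last q).castSucc) * d (Fin.castLE hq2 (Fin.last (q + 1))) : ℕ) : ℤ) * B' (x : ↥(integralForms Φ (2 * p))) (y : ↥(integralForms Φ (2 * p))) := by
  apply Int.cast_injective (α := ℂ)
  rw [hB, Int.cast_mul, Int.cast_natCast, hB', hT, hT]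
  exact hd.poincarePairing_wedge_ofRealForm_wedge_wedge_ofRealForm_of_eq_content_smul hη hq hγ hq2 hγ' e hn hn₂ _ _

/-- The image `L₂ = Hdgᵖ(X, ℤ) ∧ θ` of the Lefschetz map with the basis `T b'`, and its Gram matrix `G_{L₂} = c · G'` (`G'` the Gram matrix
of `B_{2p}|_{Hdgᵖ(X, ℤ)}` in `b'`; `T` is injective because `B_{2p}|_{Hdgᵖ(X, ℤ)}` is non-degenerate).
[cite: Lange2023AbelianVarietiesComplex, §5.4.1 (5.22) (PDF p. 275)] [cite: VoisinHodgeI2002, §6.2.3 Rem. 6.27] -/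
private theorem exists_basis_lefschetz_image₇₂ (hd : IsPolarizationType Φ η d) (hη : IsRiemannForm Φ η) (hq : q ≤ j + 2) {γ : E [⋀^Fin (2 * q)]→L[ℝ] ℂ}
    (hγ : wedgePow (ofRealForm η) q = ((q.factorial * ∏ i : Fin q, d (Fin.castLE hq i) : ℕ) : ℂ) • γ)
    (hq2 : q + 1 + 1 ≤ j + 2) {γ' : E [⋀^Fin (2 * (q + 1 + 1))]→L[ℝ] ℂ}
    (hγ' : wedgePow (ofRealForm η) (q + 1 + 1) =
      (((q + 1 + 1).factorial * ∏ i : Fin (q + 1 + 1), d (Fin.castLE hq2 i) : ℕ) : ℂ) • γ')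
    (e : Fin n ≃ ι) (hn : 2 * p + 2 + (2 * q + (2 * p + 2)) = n) (hn₂ : 2 * p + (2 * (q + 1 + 1) + 2 * p) = n)
    {B : BilinForm ℤ ↥(integralForms Φ (2 * p + 2))}
    (hB : ∀ x y : ↥(integralForms Φ (2 * p + 2)),
      ((B x y : ℤ) : ℂ) = poincarePairing Φ e hn (x : E [⋀^Fin (2 * p + 2)]→L[ℝ] ℂ) (γ.wedge (y : E [⋀^Fin (2 * p + 2)]→L[ℝ] ℂ)))
    {B' : BilinForm ℤ ↥(integralForms Φ (2 * p))}
    (hB' : ∀ x y : ↥(integralForms Φ (2 * p)),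
      ((B' x y : ℤ) : ℂ) = poincarePairing Φ e hn₂ (x : E [⋀^Fin (2 * p)]→L[ℝ] ℂ) (γ'.wedge (y : E [⋀^Fin (2 * p)]→L[ℝ] ℂ)))
    {M : Submodule ℤ ↥(integralForms Φ (2 * p + 2))} {M' : Submodule ℤ ↥(integralForms Φ (2 * p))} (hM'n : (B'.restrict M').Nondegenerate) (T : ↥M' →ₗ[ℤ] ↥M)
    (hT : ∀ x : ↥M', (((T x : ↥M) : ↥(integralForms Φ (2 * p + 2))) : E [⋀^Fin (2 * p + 2)]→L[ℝ] ℂ) =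
      (((x : ↥M') : ↥(integralForms Φ (2 * p))) : E [⋀^Fin (2 * p)]→L[ℝ] ℂ).wedge (ofRealForm η : E [⋀^Fin 2]→L[ℝ] ℂ))
    {r' : ℕ} (bM' : Basis (Fin r') ℤ ↥M') :
    ∃ (L₂ : Submodule ℤ ↥M) (bL₂ : Basis (Fin r') ℤ ↥L₂), (∀ u : ↥M, u ∈ L₂ ↔ ∃ w : ↥M', T w = u) ∧
      LinearMap.BilinForm.toMatrix bL₂ ((B.restrict M).restrict L₂) =
        (((q + 1) * (q + 2) * d (Fin.castLE hq2 (Fin.last q).castSucc) * d (Fin.castLE hq2 (Fin.last (q + 1))) : ℕ) : ℤ) •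
          LinearMap.BilinForm.toMatrix bM' (B'.restrict M') := by
  have hc0 : (q + 1) * (q + 2) * d (Fin.castLE hq2 (Fin.last q).castSucc) * d (Fin.castLE hq2 (Fin.last (q + 1))) ≠ 0 :=
    (Nat.mul_pos (Nat.mul_pos (Nat.mul_pos (by omega) (by omega)) (hd.pos hη _)) (hd.pos hη _)).ne'
  have hBT := apply_lefschetz_map₇₂ hd hη hq hγ hq2 hγ' e hn hn₂ hB hB' T hT
  -- `T` is injective (`B'|_{M'}` is non-degenerate; `(B'.restrict M') x y = B' x y` definitionally)
  have hTinj : Injective T := by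
    rw [← LinearMap.ker_eq_bot, LinearMap.ker_eq_bot']
    intro x hx
    refine hM'n.1 x fun y ↦ ?_
    have h1 : B (T x : ↥M) (T y : ↥M) = 0 := by rw [hx, ZeroMemClass.coe_zero]; exact LinearMap.map_zero₂ B _
    rw [hBT] at h1
    exact (mul_eq_zero.1 h1).resolve_left (by exact_mod_cast hc0)
  have hbL₂ : ∀ i, (((bM'.map (LinearEquiv.ofInjective T hTinj)) i : ↥(LinearMap.range T)) : ↥M) = T (bM' i) := fun i ↦ by
    rw [Basis.map_apply]; rfl
  refine ⟨LinearMap.range T, bM'.map (LinearEquiv.ofInjective T hTinj), fun u ↦ LinearMap.mem_range, ?_⟩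
  ext i k
  have h1 : ((((q + 1) * (q + 2) * d (Fin.castLE hq2 (Fin.last q).castSucc) * d (Fin.castLE hq2 (Fin.last (q + 1))) : ℕ) : ℤ) •
      LinearMap.BilinForm.toMatrix bM' (B'.restrict M')) i k =
      (((q + 1) * (q + 2) * d (Fin.castLE hq2 (Fin.last q).castSucc) * d (Fin.castLE hq2 (Fin.last (q + 1))) : ℕ) : ℤ) *
        B' ((bM' i : ↥M') : ↥(integralForms Φ (2 * p))) ((bM' k : ↥M') : ↥(integralForms Φ (2 * p))) := by
    rw [Matrix.smul_apply, smul_eq_mul, LinearMap.BilinForm.toMatrix_apply bM' (B'.restrict M') i k]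
    rfl
  have h2 : LinearMap.BilinForm.toMatrix (bM'.map (LinearEquiv.ofInjective T hTinj))
        ((B.restrict M).restrict (LinearMap.range T)) i k =
      B ((((bM'.map (LinearEquiv.ofInjective T hTinj)) i : ↥(LinearMap.range T)) : ↥M) : ↥(integralForms Φ (2 * p + 2)))
        ((((bM'.map (LinearEquiv.ofInjective T hTinj)) k : ↥(LinearMap.range T)) : ↥M) : ↥(integralForms Φ (2 * p + 2))) :=
    LinearMap.BilinForm.toMatrix_apply _ _ i k
  -- (term-mode chain: `rw` here would re-typecheck the heavy `toMatrix (bM'.map _) _ i k` term)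
  exact h2.trans (((congrArg₂ (fun u v : ↥M ↦ B (u : ↥(integralForms Φ (2 * p + 2))) (v : ↥(integralForms Φ (2 * p + 2))))
    (hbL₂ i) (hbL₂ k)).trans (hBT _ _)).trans h1.symm)

/-- Inside `M = Hdg^{p+1}(X, ℤ)`, the `B`-orthogonal of `L₂ = Hdgᵖ(X, ℤ) ∧ θ` is EXACTLY the primitive part `ker(θ^{q+1} ∧ ·) ∩ M`: `⊇` by
`⟨x ∧ θ, γ_q ∧ y⟩ = 0` for primitive `y` (g45-#1); `⊆` by the integral Lefschetz decomposition `N·z = y₀ + β ∧ θ` (§1, `β ∈ Hdgᵖ(X, ℤ)`),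
`B(w ∧ θ, N·z) = c·B'(w, β)` for `w ∈ Hdgᵖ(X, ℤ)` and the non-degeneracy of `B'|_{Hdgᵖ(X, ℤ)}` (`β = 0`).
[cite: VoisinHodgeI2002, §6.2.3 Rem. 6.27; §6.3.2 Lemma 6.31] [cite: Lange2023AbelianVarietiesComplex, §7.3.2 (3)] -/
private theorem mem_orthogonal_iff_wedgePow_wedge_eq_zero₇₂ (hd : IsPolarizationType Φ η d) (hη : IsRiemannForm Φ η)
    (hpq : 2 * p + 2 + q = j + 2) (hq : q ≤ j + 2) {γ : E [⋀^Fin (2 * q)]→L[ℝ] ℂ}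
    (hγ : wedgePow (ofRealForm η) q = ((q.factorial * ∏ i : Fin q, d (Fin.castLE hq i) : ℕ) : ℂ) • γ)
    (hq2 : q + 1 + 1 ≤ j + 2) {γ' : E [⋀^Fin (2 * (q + 1 + 1))]→L[ℝ] ℂ}
    (hγ' : wedgePow (ofRealForm η) (q + 1 + 1) =
      (((q + 1 + 1).factorial * ∏ i : Fin (q + 1 + 1), d (Fin.castLE hq2 i) : ℕ) : ℂ) • γ')
    (e : Fin n ≃ ι) (hn : 2 * p + 2 + (2 * q + (2 * p + 2)) = n) (hn₂ : 2 * p + (2 * (q + 1 + 1) + 2 * p) = n)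
    {B : BilinForm ℤ ↥(integralForms Φ (2 * p + 2))}
    (hB : ∀ x y : ↥(integralForms Φ (2 * p + 2)),
      ((B x y : ℤ) : ℂ) = poincarePairing Φ e hn (x : E [⋀^Fin (2 * p + 2)]→L[ℝ] ℂ) (γ.wedge (y : E [⋀^Fin (2 * p + 2)]→L[ℝ] ℂ)))
    {B' : BilinForm ℤ ↥(integralForms Φ (2 * p))}
    (hB' : ∀ x y : ↥(integralForms Φ (2 * p)),
      ((B' x y : ℤ) : ℂ) = poincarePairing Φ e hn₂ (x : E [⋀^Fin (2 * p)]→L[ℝ] ℂ) (γ'.wedge (y : E [⋀^Fin (2 * p)]→L[ℝ] ℂ)))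
    {M : Submodule ℤ ↥(integralForms Φ (2 * p + 2))}
    (hM : ∀ x : ↥(integralForms Φ (2 * p + 2)), x ∈ M ↔ IsOfTypeAt (p + 1) (p + 1) (x : E [⋀^Fin (2 * p + 2)]→L[ℝ] ℂ))
    {M' : Submodule ℤ ↥(integralForms Φ (2 * p))}
    (hM' : ∀ x : ↥(integralForms Φ (2 * p)), x ∈ M' ↔ IsOfTypeAt p p (x : E [⋀^Fin (2 * p)]→L[ℝ] ℂ))
    (hM'n : (B'.restrict M').Nondegenerate) (T : ↥M' →ₗ[ℤ] ↥M)
    (hT : ∀ x : ↥M', (((T x : ↥M) : ↥(integralForms Φ (2 * p + 2))) : E [⋀^Fin (2 * p + 2)]→L[ℝ] ℂ) =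
      (((x : ↥M') : ↥(integralForms Φ (2 * p))) : E [⋀^Fin (2 * p)]→L[ℝ] ℂ).wedge (ofRealForm η : E [⋀^Fin 2]→L[ℝ] ℂ))
    {L₂ : Submodule ℤ ↥M} (hmemL₂ : ∀ u : ↥M, u ∈ L₂ ↔ ∃ w : ↥M', T w = u) (z : ↥M) :
    z ∈ (B.restrict M).orthogonal L₂ ↔
      (wedgePow (ofRealForm η) (q + 1)).wedge (((z : ↥M) : ↥(integralForms Φ (2 * p + 2))) : E [⋀^Fin (2 * p + 2)]→L[ℝ] ℂ) = 0 := by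
  have hc0 : (q + 1) * (q + 2) * d (Fin.castLE hq2 (Fin.last q).castSucc) * d (Fin.castLE hq2 (Fin.last (q + 1))) ≠ 0 :=
    (Nat.mul_pos (Nat.mul_pos (Nat.mul_pos (by omega) (by omega)) (hd.pos hη _)) (hd.pos hη _)).ne'
  constructor
  · intro hz
    -- the integral Lefschetz decomposition of `z` up to `N`
    have hzH : (((z : ↥M) : ↥(integralForms Φ (2 * p + 2))) : E [⋀^Fin (2 * p + 2)]→L[ℝ] ℂ) ∈ integralHodgeClassesIn Φ (2 * p + 2) (p + 1) :=
      ⟨((z : ↥M) : ↥(integralForms Φ (2 * p + 2))).2,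
        (Literature.Analysis.Complex.mem_typeSubmodule_iff_isOfTypeAt (show p + 1 + (p + 1) = 2 * p + 2 by omega)).2
          ((hM _).1 (z : ↥M).2)⟩
    obtain ⟨N, hN, y₀, hy₀H, hy₀P, β, hβH, hdec⟩ := hd.exists_nsmul_eq_primitive_add_wedge_ofRealForm hη hpq hzH
    let βH : ↥(integralForms Φ (2 * p)) := ⟨β, hβH.1⟩
    have hβM' : βH ∈ M' := (hM' βH).2
      ((Literature.Analysis.Complex.mem_typeSubmodule_iff_isOfTypeAt (show p + p = 2 * p by omega)).1 hβH.2)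
    -- `B'(w, β) = 0` for every `w ∈ M'`
    have hβ0 : ∀ w : ↥M', B' (w : ↥(integralForms Φ (2 * p))) βH = 0 := by
      intro w
      -- `B(T w, N·z) = N · B(T w, z) = 0`
      have h1 : B (T w : ↥M) (N • ((z : ↥M) : ↥(integralForms Φ (2 * p + 2)))) = 0 := by
        have h2 : B (T w : ↥M) (z : ↥M) = 0 := (LinearMap.BilinForm.mem_orthogonal_iff.1 hz) _ ((hmemL₂ _).2 ⟨w, rfl⟩)
        rw [map_nsmul, h2, smul_zero]
      -- `B(T w, N·z) = ⟨w ∧ θ, γ ∧ y₀⟩ + c·B'(w, β)` and the first term vanishes (`y₀` primitive)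
      have h3 : ((B (T w : ↥M) (N • ((z : ↥M) : ↥(integralForms Φ (2 * p + 2)))) : ℤ) : ℂ) =
          (((q + 1) * (q + 2) * d (Fin.castLE hq2 (Fin.last q).castSucc) * d (Fin.castLE hq2 (Fin.last (q + 1))) : ℕ) : ℂ) *
            ((B' (w : ↥(integralForms Φ (2 * p))) βH : ℤ) : ℂ) := by
        rw [hB, hT, AddSubmonoidClass.coe_nsmul, ← Nat.cast_smul_eq_nsmul ℂ N, hdec, ContinuousAlternatingMap.wedge_add_right,
          map_add, (hd.forall_poincarePairing_wedge_ofRealForm_wedge_eq_zero_iff_of_eq_content_smul hη hq hγ e hn y₀).2 hy₀P _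
            ((w : ↥M') : ↥(integralForms Φ (2 * p))).2, zero_add, hB']
        exact hd.poincarePairing_wedge_ofRealForm_wedge_wedge_ofRealForm_of_eq_content_smul hη hq hγ hq2 hγ' e hn hn₂ _ _
      rw [h1, Int.cast_zero] at h3
      have h4 := (mul_eq_zero.1 h3.symm).resolve_left (by exact_mod_cast hc0)
      exact_mod_cast h4
    have hβz : (⟨βH, hβM'⟩ : ↥M') = 0 := hM'n.2 ⟨βH, hβM'⟩ fun w ↦ hβ0 w
    have hβ00 : β = 0 := congrArg (fun v : ↥M' ↦ (((v : ↥M') : ↥(integralForms Φ (2 * p))) : E [⋀^Fin (2 * p)]→L[ℝ] ℂ)) hβz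
    rw [hβ00, ContinuousAlternatingMap.zero_wedge, add_zero] at hdec
    -- `N · z = y₀` is primitive
    have h5 : (N : ℂ) • (wedgePow (ofRealForm η) (q + 1)).wedge (((z : ↥M) : ↥(integralForms Φ (2 * p + 2))) : E [⋀^Fin (2 * p + 2)]→L[ℝ] ℂ) = 0 := by
      rw [← Literature.NumberTheory.Transcendental.wedge_smul_right_complex, hdec, hy₀P]
    exact (smul_eq_zero.1 h5).resolve_left (by exact_mod_cast hN.ne')
  · intro hz
    rw [LinearMap.BilinForm.mem_orthogonal_iff]
    intro u hu
    obtain ⟨w, rfl⟩ := (hmemL₂ u).1 hu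
    change B (T w : ↥M) (z : ↥M) = 0
    apply Int.cast_injective (α := ℂ)
    rw [hB, hT, Int.cast_zero]
    exact (hd.forall_poincarePairing_wedge_ofRealForm_wedge_eq_zero_iff_of_eq_content_smul hη hq hγ e hn _).2 hz _
      ((w : ↥M') : ↥(integralForms Φ (2 * p))).2

/-- **One Lefschetz step on the integral Hodge lattices.** Let `X` be a polarised abelian variety of dimension `g = j + 2 = (2p + 2) + q`
and type `(d₁, …, d_g)` (any presentation, any orientation `e`, `s = sign·(−1)^q = sign·(−1)^{q+2}`), `B = B_{2p+2}(x, y) = ⟨x, γ_q ∧ y⟩_e`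
on `H^{2p+2}(X, ℤ)`, `B' = B_{2p}(x, y) = ⟨x, γ_{q+2} ∧ y⟩_e` on `H^{2p}(X, ℤ)`, `L = H^{2p}(X, ℤ) ∧ θ` the Lefschetz sublattice (`hL`),
`M = Hdg^{p+1}(X, ℤ) = H^{2p+2}(X, ℤ) ∩ H^{p+1,p+1}` (`hM`) and `M' = Hdgᵖ(X, ℤ) = H^{2p}(X, ℤ) ∩ H^{p,p}` (`hM'`) the integral Hodge lattices,
`P = L^⊥ ∩ M = Hdg^{p+1}(X, ℤ)_prim`. IF `B'|_{M'}` is non-degenerate THEN: **`B|_M` is non-degenerate; `rk M = rk M' + rk P`; and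
`(b⁺, b⁻)(s·B|_M) = (b⁺, b⁻)(s·B'|_{M'}) + (rk P, 0)` if `p + 1` is even, `+ (0, rk P)` if `p + 1` is odd.** Inside the lattice `M` the
sublattice `M' ∧ θ` carries `c·B'|_{M'}` (`c = (q+1)(q+2)d_{q+1}d_{q+2}`, g45-#1), its `B`-orthogonal in `M` is EXACTLY `P` (§1 and the
non-degeneracy of `B'|_{M'}`), `M' ∧ θ ⊕ P` has finite index in `M` (Kitaoka), and `s·B` is definite of sign `(−1)^{p+1}` on `P`
(Hodge–Riemann over `ℤ`, g45-#2). [cite: VoisinHodgeI2002, §6.3.2 Lemma 6.31, Thm. 6.32 (PDF p. 128); §6.2.3 Rem. 6.27; §7.1.2 (PDF p. 134 L31)] [cite: Lange2023AbelianVarietiesComplex, §7.3.2 (3); §5.4.1 (5.22) (PDF p. 275); §7.2.2] [cite: Kitaoka1993, Ch. 5 Prop. 5.3.3 (proof)] [cite: Serre1973, Ch. V §1.3.2 and §1.3.7] -/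
theorem IsPolarizationType.integralHodge_lattice_lefschetz_step (hd : IsPolarizationType Φ η d) (hη : IsRiemannForm Φ η)
    (hpq : 2 * p + 2 + q = j + 2) (hq : q ≤ j + 2) {γ : E [⋀^Fin (2 * q)]→L[ℝ] ℂ}
    (hγ : wedgePow (ofRealForm η) q = ((q.factorial * ∏ i : Fin q, d (Fin.castLE hq i) : ℕ) : ℂ) • γ)
    (hq2 : q + 1 + 1 ≤ j + 2) {γ' : E [⋀^Fin (2 * (q + 1 + 1))]→L[ℝ] ℂ}
    (hγ' : wedgePow (ofRealForm η) (q + 1 + 1) =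
      (((q + 1 + 1).factorial * ∏ i : Fin (q + 1 + 1), d (Fin.castLE hq2 i) : ℕ) : ℂ) • γ')
    (e : Fin n ≃ ι) (hn : 2 * p + 2 + (2 * q + (2 * p + 2)) = n) (hn₂ : 2 * p + (2 * (q + 1 + 1) + 2 * p) = n)
    {B : BilinForm ℤ ↥(integralForms Φ (2 * p + 2))}
    (hB : ∀ x y : ↥(integralForms Φ (2 * p + 2)),
      ((B x y : ℤ) : ℂ) = poincarePairing Φ e hn (x : E [⋀^Fin (2 * p + 2)]→L[ℝ] ℂ) (γ.wedge (y : E [⋀^Fin (2 * p + 2)]→L[ℝ] ℂ)))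
    {B' : BilinForm ℤ ↥(integralForms Φ (2 * p))}
    (hB' : ∀ x y : ↥(integralForms Φ (2 * p)),
      ((B' x y : ℤ) : ℂ) = poincarePairing Φ e hn₂ (x : E [⋀^Fin (2 * p)]→L[ℝ] ℂ) (γ'.wedge (y : E [⋀^Fin (2 * p)]→L[ℝ] ℂ)))
    {L : Submodule ℤ ↥(integralForms Φ (2 * p + 2))}
    (hL : ∀ y : ↥(integralForms Φ (2 * p + 2)), y ∈ L ↔ ∃ x : ↥(integralForms Φ (2 * p)),
      (y : E [⋀^Fin (2 * p + 2)]→L[ℝ] ℂ) = (x : E [⋀^Fin (2 * p)]→L[ℝ] ℂ).wedge (ofRealForm η : E [⋀^Fin 2]→L[ℝ] ℂ))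
    {M : Submodule ℤ ↥(integralForms Φ (2 * p + 2))}
    (hM : ∀ x : ↥(integralForms Φ (2 * p + 2)), x ∈ M ↔ IsOfTypeAt (p + 1) (p + 1) (x : E [⋀^Fin (2 * p + 2)]→L[ℝ] ℂ))
    {M' : Submodule ℤ ↥(integralForms Φ (2 * p))}
    (hM' : ∀ x : ↥(integralForms Φ (2 * p)), x ∈ M' ↔ IsOfTypeAt p p (x : E [⋀^Fin (2 * p)]→L[ℝ] ℂ))
    (hM'n : (B'.restrict M').Nondegenerate) :
    (B.restrict M).Nondegenerate ∧
    finrank ℤ ↥M = finrank ℤ ↥M' + finrank ℤ ↥(B.orthogonal L ⊓ M) ∧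
    (Even (p + 1) →
      sigPos (((orientationSign Φ e * (-1) ^ q) • B).restrict M).toQuadraticMap =
        sigPos (((orientationSign Φ e * (-1) ^ (q + 1 + 1)) • B').restrict M').toQuadraticMap + finrank ℤ ↥(B.orthogonal L ⊓ M) ∧
      sigNeg (((orientationSign Φ e * (-1) ^ q) • B).restrict M).toQuadraticMap =
        sigNeg (((orientationSign Φ e * (-1) ^ (q + 1 + 1)) • B').restrict M').toQuadraticMap) ∧
    (Odd (p + 1) →
      sigPos (((orientationSign Φ e * (-1) ^ q) • B).restrict M).toQuadraticMap =
        sigPos (((orientationSign Φ e * (-1) ^ (q + 1 + 1)) • B').restrict M').toQuadraticMap ∧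
      sigNeg (((orientationSign Φ e * (-1) ^ q) • B).restrict M).toQuadraticMap =
        sigNeg (((orientationSign Φ e * (-1) ^ (q + 1 + 1)) • B').restrict M').toQuadraticMap + finrank ℤ ↥(B.orthogonal L ⊓ M)) := by
  classical
  letI : LinearOrder ι := linearOrderOfOrientation e
  let bK : Basis {w : Fin (2 * p + 2) → ι // StrictMono w} ℤ ↥(integralForms Φ (2 * p + 2)) := intLatMonomialBasis Φ (2 * p + 2)
  let bK' : Basis {w : Fin (2 * p) → ι // StrictMono w} ℤ ↥(integralForms Φ (2 * p)) := intLatMonomialBasis Φ (2 * p)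
  obtain ⟨r, bM⟩ := Submodule.basisOfPid bK M
  obtain ⟨r', bM'⟩ := Submodule.basisOfPid bK' M'
  haveI : Module.Finite ℤ ↥M := Module.Finite.of_basis bM
  haveI : Module.Free ℤ ↥M := Module.Free.of_basis bM
  have hs0 : orientationSign Φ e * (-1) ^ q ≠ 0 :=
    mul_ne_zero (by rcases orientationSign_eq_or Φ e with h | h <;> rw [h] <;> norm_num) (pow_ne_zero _ (by norm_num))
  have hc : (0 : ℤ) < (((q + 1) * (q + 2) * d (Fin.castLE hq2 (Fin.last q).castSucc) * d (Fin.castLE hq2 (Fin.last (q + 1))) : ℕ) : ℤ) :=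
    Int.natCast_pos.2 (Nat.mul_pos (Nat.mul_pos (Nat.mul_pos (by omega) (by omega)) (hd.pos hη _)) (hd.pos hη _))
  have hBs : B.IsSymm :=
    hd.isSymm_of_eq_poincarePairing_wedge_of_even hη (show Even (2 * p + 2) from ⟨p + 1, by ring⟩) hpq hq hγ e hn hB
  -- the Lefschetz map `T`, the sublattice `L₂ = M' ∧ θ` of `M` and its Gram matrix `c · G'`
  obtain ⟨T, hT⟩ := exists_lefschetz_map₇₂ (p := p) hη hM hM'
  obtain ⟨L₂, bL₂, hmemL₂, hGram⟩ := exists_basis_lefschetz_image₇₂ hd hη hq hγ hq2 hγ' e hn hn₂ hB hB' hM'n T hT bM'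
  have hdet' : (LinearMap.BilinForm.toMatrix bM' (B'.restrict M')).det ≠ 0 :=
    (LinearMap.BilinForm.nondegenerate_iff_det_ne_zero bM').1 hM'n
  -- its `B`-orthogonal inside `M` is the primitive Hodge lattice `P = L^⊥ ∩ M`
  have horth : ∀ z : ↥M, z ∈ (B.restrict M).orthogonal L₂ ↔
      (wedgePow (ofRealForm η) (q + 1)).wedge (((z : ↥M) : ↥(integralForms Φ (2 * p + 2))) : E [⋀^Fin (2 * p + 2)]→L[ℝ] ℂ) = 0 := fun z ↦
    mem_orthogonal_iff_wedgePow_wedge_eq_zero₇₂ hd hη hpq hq hγ hq2 hγ' e hn hn₂ hB hB' hM hM' hM'n T hT hmemL₂ z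
  have hrkP : finrank ℤ ↥((B.restrict M).orthogonal L₂) = finrank ℤ ↥(B.orthogonal L ⊓ M) :=
    finrank_eq_finrank_inf₇₂ ((B.restrict M).orthogonal L₂) (B.orthogonal L)
      (fun y : ↥(integralForms Φ (2 * p + 2)) ↦ (wedgePow (ofRealForm η) (q + 1)).wedge (y : E [⋀^Fin (2 * p + 2)]→L[ℝ] ℂ) = 0) horth
      fun y ↦ hd.mem_orthogonal_lefschetz_iff_of_eq_poincarePairing_wedge hη hq hγ e hn hB hL y
  have hrkM' : finrank ℤ ↥M' = r' := by rw [finrank_eq_card_basis bM', Fintype.card_fin]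
  -- Hodge–Riemann over `ℤ` on the orthogonal: `(−1)^{p+1}·s·B > 0`
  have hHR : ∀ z : ↥((B.restrict M).orthogonal L₂), z ≠ 0 →
      0 < (-1) ^ (p + 1) * (orientationSign Φ e * (-1) ^ q) *
        B ((z : ↥M) : ↥(integralForms Φ (2 * p + 2))) ((z : ↥M) : ↥(integralForms Φ (2 * p + 2))) := fun z hz0 ↦ by
    have hz0' : ((z : ↥M) : ↥(integralForms Φ (2 * p + 2))) ≠ 0 := fun h ↦ hz0 (Subtype.ext (Subtype.ext h))
    exact hd.hodgeRiemann_apply_self_pos_of_eq_poincarePairing_wedge hη hpq (show p + 1 + (p + 1) = 2 * p + 2 by omega) hq hγ e hn hB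
      ((horth _).1 z.2) ((hM _).1 (z : ↥M).2) hz0'
  -- the lattice algebra (`ε = (−1)^{p+1}`), then the parity split
  obtain ⟨hMn, hrk, hEven, hOdd⟩ := lattice_lefschetz_step_of_sign₇₂ (B.restrict M) (hBs.restrict M) L₂ bL₂ (B'.restrict M') bM' hc
    hGram hdet' hs0 (orientationSign_mul_neg_one_pow_add_two₇₂ Φ e q) (ε := (-1) ^ (p + 1)) (fun z hz0 ↦ by
      have h := hHR z hz0
      rw [mul_assoc] at h
      exact h) hrkM'.symm hrkP
  -- `(s • B)|_M = s • B|_M` and `(s' • B')|_{M'} = s' • B'|_{M'}` definitionally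
  exact ⟨hMn, hrk, fun he ↦ hEven he.neg_one_pow, fun ho ↦ hOdd ho.neg_one_pow⟩

end Step

/-! ## §3 Consequences: the concrete integral Hodge lattices, `Hdg⁰ → Hdg¹` (Hodge index on `Hdg¹(X, ℤ)`), `Hdg¹ → Hdg²` -/

section Generic

variable {R M : Type*} [CommRing R] [AddCommGroup M] [Module R M]

/-- Restricting a non-degenerate form to a submodule containing everything keeps it non-degenerate (the submodule IS the whole
inner product module). [cite: MilnorHusemoller1973, Ch. I §1] -/
theorem nondegenerate_restrict_of_forall_mem (B : BilinForm R M) {W : Submodule R M} (hW : ∀ x, x ∈ W)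
    (hB : B.Nondegenerate) : (B.restrict W).Nondegenerate :=
  ⟨fun x hx ↦ Subtype.ext (hB.1 x.1 fun y ↦ hx ⟨y, hW y⟩), fun y hy ↦ Subtype.ext (hB.2 y.1 fun x ↦ hy ⟨x, hW x⟩)⟩

/-- Restricting a lattice form to a submodule containing everything does not change its indices of inertia (`W ≅ M` isometrically).
[cite: Serre1973, Ch. V §1.3.2] -/
theorem sigPos_sigNeg_restrict_of_forall_mem {M : Type*} [AddCommGroup M] (B : BilinForm ℤ M) {W : Submodule ℤ M}
    (hW : ∀ x, x ∈ W) :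
    sigPos (B.restrict W).toQuadraticMap = sigPos B.toQuadraticMap ∧ sigNeg (B.restrict W).toQuadraticMap = sigNeg B.toQuadraticMap := by
  have hq : (B.restrict W).toQuadraticMap.Equivalent B.toQuadraticMap :=
    ⟨{ LinearEquiv.ofTop W (eq_top_iff.2 fun x _ ↦ hW x) with map_app' := fun _ ↦ rfl }⟩
  exact ⟨hq.sigPos_eq, hq.sigNeg_eq⟩

end Generic

section Consequences

variable {ι : Type*} [Fintype ι] [DecidableEq ι] {E : Type*} [NormedAddCommGroup E] [NormedSpace ℂ E]
  {Φ : (ι → ℝ) ≃L[ℝ] E} {j n p q : ℕ} {η : E [⋀^Fin 2]→L[ℝ] ℝ} {d : Fin (j + 2) → ℕ}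

omit [Fintype ι] [DecidableEq ι] in
/-- Membership in the integral Hodge lattice `Hdgᵖ(X, ℤ) = H^{2p}(X, ℤ) ∩ H^{p,p}` seen as a `ℤ`-submodule of `Hᵏ(X, ℤ)` (`k = 2p`): an
integral class lies in it iff it is of type `(p, p)`. [cite: Lange2023AbelianVarietiesComplex, §7.2.2] -/
theorem mem_toIntSubmodule_integralHodgeClassesIn_iff (Φ : (ι → ℝ) ≃L[ℝ] E) {k p : ℕ} (hp : p + p = k) (x : ↥(integralForms Φ k)) :
    x ∈ AddSubgroup.toIntSubmodule ((integralHodgeClassesIn Φ k p).addSubgroupOf (integralForms Φ k)) ↔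
      IsOfTypeAt p p (x : E [⋀^Fin k]→L[ℝ] ℂ) := by
  change (x : ↥(integralForms Φ k)) ∈ (integralHodgeClassesIn Φ k p).addSubgroupOf (integralForms Φ k) ↔ _
  rw [AddSubgroup.mem_addSubgroupOf, mem_integralHodgeClassesIn_iff, Literature.Analysis.Complex.mem_typeSubmodule_iff_isOfTypeAt hp]
  exact ⟨fun h ↦ h.2, fun h ↦ ⟨x.2, h⟩⟩

/-- **One Lefschetz step on the concrete integral Hodge lattices `Hdgᵖ(X, ℤ) ⊆ H^{2p}(X, ℤ)`, `Hdg^{p+1}(X, ℤ) ⊆ H^{2p+2}(X, ℤ)`**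
(`integralHodge_lattice_lefschetz_step` for `M = Hdg^{p+1}(X, ℤ)`, `M' = Hdgᵖ(X, ℤ)` as `ℤ`-submodules): if `B_{2p}|_{Hdgᵖ(X, ℤ)}` is
non-degenerate then `B_{2p+2}|_{Hdg^{p+1}(X, ℤ)}` is non-degenerate, `rk Hdg^{p+1}(X, ℤ) = rk Hdgᵖ(X, ℤ) + rk Hdg^{p+1}(X, ℤ)_prim`, and
`(b⁺, b⁻)(s·B_{2p+2}|_{Hdg^{p+1}(X, ℤ)}) = (b⁺, b⁻)(s·B_{2p}|_{Hdgᵖ(X, ℤ)}) + (rk Hdg^{p+1}(X, ℤ)_prim, 0)` or `+ (0, rk Hdg^{p+1}(X, ℤ)_prim)`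
according as `p + 1` is even or odd. [cite: VoisinHodgeI2002, §6.3.2 Lemma 6.31, Thm. 6.32; §7.1.2] [cite: Lange2023AbelianVarietiesComplex, §7.3.2 (3); §5.4.1 (5.22); §7.2.2] [cite: Kitaoka1993, Ch. 5 Prop. 5.3.3 (proof)] -/
theorem IsPolarizationType.integralHodgeClassesIn_lattice_lefschetz_step (hd : IsPolarizationType Φ η d) (hη : IsRiemannForm Φ η)
    (hpq : 2 * p + 2 + q = j + 2) (hq : q ≤ j + 2) {γ : E [⋀^Fin (2 * q)]→L[ℝ] ℂ}
    (hγ : wedgePow (ofRealForm η) q = ((q.factorial * ∏ i : Fin q, d (Fin.castLE hq i) : ℕ) : ℂ) • γ)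
    (hq2 : q + 1 + 1 ≤ j + 2) {γ' : E [⋀^Fin (2 * (q + 1 + 1))]→L[ℝ] ℂ}
    (hγ' : wedgePow (ofRealForm η) (q + 1 + 1) =
      (((q + 1 + 1).factorial * ∏ i : Fin (q + 1 + 1), d (Fin.castLE hq2 i) : ℕ) : ℂ) • γ')
    (e : Fin n ≃ ι) (hn : 2 * p + 2 + (2 * q + (2 * p + 2)) = n) (hn₂ : 2 * p + (2 * (q + 1 + 1) + 2 * p) = n)
    {B : BilinForm ℤ ↥(integralForms Φ (2 * p + 2))}
    (hB : ∀ x y : ↥(integralForms Φ (2 * p + 2)),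
      ((B x y : ℤ) : ℂ) = poincarePairing Φ e hn (x : E [⋀^Fin (2 * p + 2)]→L[ℝ] ℂ) (γ.wedge (y : E [⋀^Fin (2 * p + 2)]→L[ℝ] ℂ)))
    {B' : BilinForm ℤ ↥(integralForms Φ (2 * p))}
    (hB' : ∀ x y : ↥(integralForms Φ (2 * p)),
      ((B' x y : ℤ) : ℂ) = poincarePairing Φ e hn₂ (x : E [⋀^Fin (2 * p)]→L[ℝ] ℂ) (γ'.wedge (y : E [⋀^Fin (2 * p)]→L[ℝ] ℂ)))
    {L : Submodule ℤ ↥(integralForms Φ (2 * p + 2))}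
    (hL : ∀ y : ↥(integralForms Φ (2 * p + 2)), y ∈ L ↔ ∃ x : ↥(integralForms Φ (2 * p)),
      (y : E [⋀^Fin (2 * p + 2)]→L[ℝ] ℂ) = (x : E [⋀^Fin (2 * p)]→L[ℝ] ℂ).wedge (ofRealForm η : E [⋀^Fin 2]→L[ℝ] ℂ))
    (hM'n : (B'.restrict (AddSubgroup.toIntSubmodule ((integralHodgeClassesIn Φ (2 * p) p).addSubgroupOf (integralForms Φ (2 * p))))).Nondegenerate) :
    (B.restrict (AddSubgroup.toIntSubmodule ((integralHodgeClassesIn Φ (2 * p + 2) (p + 1)).addSubgroupOf (integralForms Φ (2 * p + 2))))).Nondegenerate ∧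
    finrank ℤ ↥(AddSubgroup.toIntSubmodule ((integralHodgeClassesIn Φ (2 * p + 2) (p + 1)).addSubgroupOf (integralForms Φ (2 * p + 2)))) =
      finrank ℤ ↥(AddSubgroup.toIntSubmodule ((integralHodgeClassesIn Φ (2 * p) p).addSubgroupOf (integralForms Φ (2 * p)))) +
        finrank ℤ ↥(B.orthogonal L ⊓ AddSubgroup.toIntSubmodule ((integralHodgeClassesIn Φ (2 * p + 2) (p + 1)).addSubgroupOf (integralForms Φ (2 * p + 2)))) ∧
    (Even (p + 1) →
      sigPos (((orientationSign Φ e * (-1) ^ q) • B).restrict (AddSubgroup.toIntSubmodule ((integralHodgeClassesIn Φ (2 * p + 2) (p + 1)).addSubgroupOf (integralForms Φ (2 * p + 2))))).toQuadraticMap =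
        sigPos (((orientationSign Φ e * (-1) ^ (q + 1 + 1)) • B').restrict (AddSubgroup.toIntSubmodule ((integralHodgeClassesIn Φ (2 * p) p).addSubgroupOf (integralForms Φ (2 * p))))).toQuadraticMap +
          finrank ℤ ↥(B.orthogonal L ⊓ AddSubgroup.toIntSubmodule ((integralHodgeClassesIn Φ (2 * p + 2) (p + 1)).addSubgroupOf (integralForms Φ (2 * p + 2)))) ∧
      sigNeg (((orientationSign Φ e * (-1) ^ q) • B).restrict (AddSubgroup.toIntSubmodule ((integralHodgeClassesIn Φ (2 * p + 2) (p + 1)).addSubgroupOf (integralForms Φ (2 * p + 2))))).toQuadraticMap =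
        sigNeg (((orientationSign Φ e * (-1) ^ (q + 1 + 1)) • B').restrict (AddSubgroup.toIntSubmodule ((integralHodgeClassesIn Φ (2 * p) p).addSubgroupOf (integralForms Φ (2 * p))))).toQuadraticMap) ∧
    (Odd (p + 1) →
      sigPos (((orientationSign Φ e * (-1) ^ q) • B).restrict (AddSubgroup.toIntSubmodule ((integralHodgeClassesIn Φ (2 * p + 2) (p + 1)).addSubgroupOf (integralForms Φ (2 * p + 2))))).toQuadraticMap =
        sigPos (((orientationSign Φ e * (-1) ^ (q + 1 + 1)) • B').restrict (AddSubgroup.toIntSubmodule ((integralHodgeClassesIn Φ (2 * p) p).addSubgroupOf (integralForms Φ (2 * p))))).toQuadraticMap ∧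
      sigNeg (((orientationSign Φ e * (-1) ^ q) • B).restrict (AddSubgroup.toIntSubmodule ((integralHodgeClassesIn Φ (2 * p + 2) (p + 1)).addSubgroupOf (integralForms Φ (2 * p + 2))))).toQuadraticMap =
        sigNeg (((orientationSign Φ e * (-1) ^ (q + 1 + 1)) • B').restrict (AddSubgroup.toIntSubmodule ((integralHodgeClassesIn Φ (2 * p) p).addSubgroupOf (integralForms Φ (2 * p))))).toQuadraticMap +
          finrank ℤ ↥(B.orthogonal L ⊓ AddSubgroup.toIntSubmodule ((integralHodgeClassesIn Φ (2 * p + 2) (p + 1)).addSubgroupOf (integralForms Φ (2 * p + 2))))) :=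
  hd.integralHodge_lattice_lefschetz_step hη hpq hq hγ hq2 hγ' e hn hn₂ hB hB' hL
    (mem_toIntSubmodule_integralHodgeClassesIn_iff Φ (by omega)) (mem_toIntSubmodule_integralHodgeClassesIn_iff Φ (by omega)) hM'n

/-- `evenPieceIdx 0 = {(0, 0, 0)}`: in degree `0` there is only `H^{0,0}`. [cite: VoisinHodgeI2002, §6.3.2 Thm. 6.33 (proof)] -/
theorem evenPieceIdx_zero : evenPieceIdx 0 = {(0, 0, 0)} := by decide

/-- `oddPieceIdx 0 = ∅`. [cite: VoisinHodgeI2002, §6.3.2 Thm. 6.33 (proof)] -/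
theorem oddPieceIdx_zero : oddPieceIdx 0 = ∅ := by decide

/-- **Degree zero: `(b⁺, b⁻)(s·B₀) = (1, 0)` and `B₀` is non-degenerate** on `H⁰(X, ℤ) ≅ ℤ`, `B₀(x, y) = ⟨x, γ_g ∧ y⟩_e` with `γ_g` the
(content-normalised) top class, `s = sign·(−1)^g` (g44-#3 read in degree `0`: the only piece is `h_pr^{0,0} = 1`).
[cite: VoisinHodgeI2002, §6.3.2 Thm. 6.32, Thm. 6.33 (proof, (6.12))] [cite: Lange2023AbelianVarietiesComplex, §5.4.1 (5.22)] -/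
theorem IsPolarizationType.sigPos_sigNeg_smul_of_eq_poincarePairing_wedge_degree_zero (hd : IsPolarizationType Φ η d)
    (hη : IsRiemannForm Φ η) (hkq : 0 + q = j + 2) (hq : q ≤ j + 2) {γ : E [⋀^Fin (2 * q)]→L[ℝ] ℂ}
    (hγ : wedgePow (ofRealForm η) q = ((q.factorial * ∏ i : Fin q, d (Fin.castLE hq i) : ℕ) : ℂ) • γ)
    (e : Fin n ≃ ι) (hn : 0 + (2 * q + 0) = n) {B₀ : BilinForm ℤ ↥(integralForms Φ 0)}
    (hB₀ : ∀ x y : ↥(integralForms Φ 0),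
      ((B₀ x y : ℤ) : ℂ) = poincarePairing Φ e hn (x : E [⋀^Fin 0]→L[ℝ] ℂ) (γ.wedge (y : E [⋀^Fin 0]→L[ℝ] ℂ))) :
    sigPos (((orientationSign Φ e * (-1) ^ q) • B₀)).toQuadraticMap = 1 ∧ sigNeg (((orientationSign Φ e * (-1) ^ q) • B₀)).toQuadraticMap = 0 ∧ B₀.Nondegenerate := by
  obtain ⟨h1, h2⟩ := hd.sigPos_sigNeg_smul_of_eq_poincarePairing_wedge_of_even hη (k := 0) ⟨0, rfl⟩ hkq hq hγ e hn hB₀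
  rw [evenPieceIdx_zero, Finset.sum_singleton] at h1
  rw [oddPieceIdx_zero, Finset.sum_empty] at h2
  exact ⟨h1.trans (by simp [primitiveHodgeNumber]), h2,
    hd.nondegenerate_of_eq_poincarePairing_wedge_of_even hη (k := 0) ⟨0, rfl⟩ hkq hq hγ e hn hB₀⟩

/-- **The Hodge index theorem on the integral Hodge lattice `Hdg¹(X, ℤ) = H²(X, ℤ) ∩ H^{1,1}` of a polarised abelian variety** (the
step `Hdg⁰ → Hdg¹`; `g = j + 2`, type `(d₁, …, d_g)`, any presentation, any orientation `e`, `s = sign·(−1)^{g−2}`,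
`B₂(x, y) = ⟨x, γ_{g−2} ∧ y⟩_e`, `L = H⁰(X, ℤ) ∧ θ = ℤθ`): **`B₂|_{Hdg¹(X, ℤ)}` is non-degenerate, `rk Hdg¹(X, ℤ) = 1 + rk Hdg¹(X, ℤ)_prim`,
and `(b⁺, b⁻)(s·B₂|_{Hdg¹(X, ℤ)}) = (1, rk Hdg¹(X, ℤ)_prim) = (1, ρ − 1)`** — Hartshorne's "one `+1`, corresponding to a multiple of `H`,
and all the rest `−1`'s" on the lattice of integral `(1, 1)`-classes (`Hdg⁰(X, ℤ) = H⁰(X, ℤ) ≅ ℤ` carries `(b⁺, b⁻)(s·B₀) = (1, 0)`).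
[cite: Hartshorne1977, Ch. V Thm. 1.9, Rem. 1.9.1] [cite: Lange2023AbelianVarietiesComplex, §5.1.2 (p. 244); §5.4.1 (5.22); §7.2.2] [cite: VoisinHodgeI2002, §6.3.2 Thm. 6.32, Thm. 6.33] [cite: Serre1973, Ch. V §1.3.2] -/
theorem IsPolarizationType.hodgeIndex_integralHodgeClassesIn_two_one (hd : IsPolarizationType Φ η d) (hη : IsRiemannForm Φ η)
    (hq : j ≤ j + 2) {γ : E [⋀^Fin (2 * j)]→L[ℝ] ℂ}
    (hγ : wedgePow (ofRealForm η) j = ((j.factorial * ∏ i : Fin j, d (Fin.castLE hq i) : ℕ) : ℂ) • γ)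
    (hq2 : j + 1 + 1 ≤ j + 2) {γ' : E [⋀^Fin (2 * (j + 1 + 1))]→L[ℝ] ℂ}
    (hγ' : wedgePow (ofRealForm η) (j + 1 + 1) =
      (((j + 1 + 1).factorial * ∏ i : Fin (j + 1 + 1), d (Fin.castLE hq2 i) : ℕ) : ℂ) • γ')
    (e : Fin n ≃ ι) (hn : 2 + (2 * j + 2) = n) (hn₂ : 0 + (2 * (j + 1 + 1) + 0) = n)
    {B : BilinForm ℤ ↥(integralForms Φ 2)}
    (hB : ∀ x y : ↥(integralForms Φ 2),
      ((B x y : ℤ) : ℂ) = poincarePairing Φ e hn (x : E [⋀^Fin 2]→L[ℝ] ℂ) (γ.wedge (y : E [⋀^Fin 2]→L[ℝ] ℂ)))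
    {B₀ : BilinForm ℤ ↥(integralForms Φ 0)}
    (hB₀ : ∀ x y : ↥(integralForms Φ 0),
      ((B₀ x y : ℤ) : ℂ) = poincarePairing Φ e hn₂ (x : E [⋀^Fin 0]→L[ℝ] ℂ) (γ'.wedge (y : E [⋀^Fin 0]→L[ℝ] ℂ)))
    {L : Submodule ℤ ↥(integralForms Φ 2)}
    (hL : ∀ y : ↥(integralForms Φ 2), y ∈ L ↔ ∃ x : ↥(integralForms Φ 0),
      (y : E [⋀^Fin 2]→L[ℝ] ℂ) = (x : E [⋀^Fin 0]→L[ℝ] ℂ).wedge (ofRealForm η : E [⋀^Fin 2]→L[ℝ] ℂ)) :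
    (B.restrict (AddSubgroup.toIntSubmodule ((integralHodgeClassesIn Φ 2 1).addSubgroupOf (integralForms Φ 2)))).Nondegenerate ∧
    finrank ℤ ↥(AddSubgroup.toIntSubmodule ((integralHodgeClassesIn Φ 2 1).addSubgroupOf (integralForms Φ 2))) =
      1 + finrank ℤ ↥(B.orthogonal L ⊓ AddSubgroup.toIntSubmodule ((integralHodgeClassesIn Φ 2 1).addSubgroupOf (integralForms Φ 2))) ∧
    sigPos (((orientationSign Φ e * (-1) ^ j) • B).restrict (AddSubgroup.toIntSubmodule ((integralHodgeClassesIn Φ 2 1).addSubgroupOf (integralForms Φ 2)))).toQuadraticMap = 1 ∧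
    sigNeg (((orientationSign Φ e * (-1) ^ j) • B).restrict (AddSubgroup.toIntSubmodule ((integralHodgeClassesIn Φ 2 1).addSubgroupOf (integralForms Φ 2)))).toQuadraticMap =
      finrank ℤ ↥(B.orthogonal L ⊓ AddSubgroup.toIntSubmodule ((integralHodgeClassesIn Φ 2 1).addSubgroupOf (integralForms Φ 2))) := by
  -- `Hdg⁰(X, ℤ)` is all of `H⁰(X, ℤ) ≅ ℤ`, on which `(b⁺, b⁻)(s·B₀) = (1, 0)`
  have hall : ∀ x : ↥(integralForms Φ 0), x ∈ AddSubgroup.toIntSubmodule ((integralHodgeClassesIn Φ 0 0).addSubgroupOf (integralForms Φ 0)) :=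
    fun x ↦ (mem_toIntSubmodule_integralHodgeClassesIn_iff Φ rfl x).2 (isOfTypeAt_zero_zero _)
  obtain ⟨hP0, hN0, hB₀n⟩ := hd.sigPos_sigNeg_smul_of_eq_poincarePairing_wedge_degree_zero hη (by omega) hq2 hγ' e hn₂ hB₀
  have hres := sigPos_sigNeg_restrict_of_forall_mem ((orientationSign Φ e * (-1) ^ (j + 1 + 1)) • B₀) hall
  have hrk0 : finrank ℤ ↥(AddSubgroup.toIntSubmodule ((integralHodgeClassesIn Φ 0 0).addSubgroupOf (integralForms Φ 0))) = 1 := by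
    rw [(LinearEquiv.ofTop _ (eq_top_iff.2 fun x _ ↦ hall x)).finrank_eq]
    have h := finrank_integralForms_eq_choose Φ 0
    rw [Nat.choose_zero_right] at h
    exact h
  obtain ⟨hMn, hrk, -, hodd⟩ := hd.integralHodge_lattice_lefschetz_step (p := 0) hη (by omega) hq hγ hq2 hγ' e hn hn₂ hB hB₀ hL
    (mem_toIntSubmodule_integralHodgeClassesIn_iff Φ rfl) (mem_toIntSubmodule_integralHodgeClassesIn_iff Φ rfl)
    (nondegenerate_restrict_of_forall_mem B₀ hall hB₀n)
  obtain ⟨hP, hN⟩ := hodd ⟨0, rfl⟩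
  rw [hres.1, hP0] at hP
  rw [hres.2, hN0] at hN
  rw [hrk0] at hrk
  exact ⟨hMn, hrk, hP, hN.trans (zero_add _)⟩

/-- **The step `Hdg¹ → Hdg²` (`g = q + 4 ≥ 4`): `(b⁺, b⁻)(s·B₄|_{Hdg²(X, ℤ)}) = (1 + rk Hdg²(X, ℤ)_prim, ρ − 1)`**, `B₄|_{Hdg²(X, ℤ)}` non-degenerate
and `rk Hdg²(X, ℤ) = ρ + rk Hdg²(X, ℤ)_prim` (`ρ = rk Hdg¹(X, ℤ)`, `ρ − 1 = rk Hdg¹(X, ℤ)_prim`; `s = sign·(−1)^q`, `B₄(x, y) = ⟨x, γ_q ∧ y⟩_e`,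
`B₂(x, y) = ⟨x, γ_{q+2} ∧ y⟩_e`, `B₀(x, y) = ⟨x, γ_{q+4} ∧ y⟩_e`, `L₄ = H²(X, ℤ) ∧ θ`, `L₂ = H⁰(X, ℤ) ∧ θ`): the Hodge index theorem on
`Hdg¹(X, ℤ)` (previous theorem) fed into one Lefschetz step with `p + 1 = 2` even (Hodge–Riemann: `s·B₄ > 0` on `Hdg²(X, ℤ)_prim`). For an
abelian fourfold (`q = 0`, `B₄` = the intersection form on `H⁴(X, ℤ)`): `(b⁺, b⁻)(sign·B₄|_{Hdg²(X, ℤ)}) = (1 + ρ^{(2)}_pr, ρ − 1)`.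
[cite: VoisinHodgeI2002, §6.3.2 Thm. 6.32, Thm. 6.33; §7.1.2] [cite: Lange2023AbelianVarietiesComplex, §7.3.2 (3); §5.4.1 (5.22); §7.2.2] [cite: Hartshorne1977, Ch. V Rem. 1.9.1] [cite: Kitaoka1993, Ch. 5 Prop. 5.3.3 (proof)] -/
theorem IsPolarizationType.sigPos_sigNeg_integralHodgeClassesIn_four_two {d : Fin (q + 2 + 2) → ℕ} (hd : IsPolarizationType Φ η d)
    (hη : IsRiemannForm Φ η) (hq : q ≤ q + 2 + 2) {γ : E [⋀^Fin (2 * q)]→L[ℝ] ℂ}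
    (hγ : wedgePow (ofRealForm η) q = ((q.factorial * ∏ i : Fin q, d (Fin.castLE hq i) : ℕ) : ℂ) • γ)
    (hq2 : q + 1 + 1 ≤ q + 2 + 2) {γ' : E [⋀^Fin (2 * (q + 1 + 1))]→L[ℝ] ℂ}
    (hγ' : wedgePow (ofRealForm η) (q + 1 + 1) =
      (((q + 1 + 1).factorial * ∏ i : Fin (q + 1 + 1), d (Fin.castLE hq2 i) : ℕ) : ℂ) • γ')
    (hq4 : q + 1 + 1 + 1 + 1 ≤ q + 2 + 2) {γ'' : E [⋀^Fin (2 * (q + 1 + 1 + 1 + 1))]→L[ℝ] ℂ}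
    (hγ'' : wedgePow (ofRealForm η) (q + 1 + 1 + 1 + 1) =
      (((q + 1 + 1 + 1 + 1).factorial * ∏ i : Fin (q + 1 + 1 + 1 + 1), d (Fin.castLE hq4 i) : ℕ) : ℂ) • γ'')
    (e : Fin n ≃ ι) (hn : 4 + (2 * q + 4) = n) (hn₂ : 2 + (2 * (q + 1 + 1) + 2) = n) (hn₀ : 0 + (2 * (q + 1 + 1 + 1 + 1) + 0) = n)
    {B₄ : BilinForm ℤ ↥(integralForms Φ 4)}
    (hB₄ : ∀ x y : ↥(integralForms Φ 4),
      ((B₄ x y : ℤ) : ℂ) = poincarePairing Φ e hn (x : E [⋀^Fin 4]→L[ℝ] ℂ) (γ.wedge (y : E [⋀^Fin 4]→L[ℝ] ℂ)))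
    {B₂ : BilinForm ℤ ↥(integralForms Φ 2)}
    (hB₂ : ∀ x y : ↥(integralForms Φ 2),
      ((B₂ x y : ℤ) : ℂ) = poincarePairing Φ e hn₂ (x : E [⋀^Fin 2]→L[ℝ] ℂ) (γ'.wedge (y : E [⋀^Fin 2]→L[ℝ] ℂ)))
    {B₀ : BilinForm ℤ ↥(integralForms Φ 0)}
    (hB₀ : ∀ x y : ↥(integralForms Φ 0),
      ((B₀ x y : ℤ) : ℂ) = poincarePairing Φ e hn₀ (x : E [⋀^Fin 0]→L[ℝ] ℂ) (γ''.wedge (y : E [⋀^Fin 0]→L[ℝ] ℂ)))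
    {L₄ : Submodule ℤ ↥(integralForms Φ 4)}
    (hL₄ : ∀ y : ↥(integralForms Φ 4), y ∈ L₄ ↔ ∃ x : ↥(integralForms Φ 2),
      (y : E [⋀^Fin 4]→L[ℝ] ℂ) = (x : E [⋀^Fin 2]→L[ℝ] ℂ).wedge (ofRealForm η : E [⋀^Fin 2]→L[ℝ] ℂ))
    {L₂ : Submodule ℤ ↥(integralForms Φ 2)}
    (hL₂ : ∀ y : ↥(integralForms Φ 2), y ∈ L₂ ↔ ∃ x : ↥(integralForms Φ 0),
      (y : E [⋀^Fin 2]→L[ℝ] ℂ) = (x : E [⋀^Fin 0]→L[ℝ] ℂ).wedge (ofRealForm η : E [⋀^Fin 2]→L[ℝ] ℂ)) :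
    (B₄.restrict (AddSubgroup.toIntSubmodule ((integralHodgeClassesIn Φ 4 2).addSubgroupOf (integralForms Φ 4)))).Nondegenerate ∧
    finrank ℤ ↥(AddSubgroup.toIntSubmodule ((integralHodgeClassesIn Φ 4 2).addSubgroupOf (integralForms Φ 4))) =
      finrank ℤ ↥(AddSubgroup.toIntSubmodule ((integralHodgeClassesIn Φ 2 1).addSubgroupOf (integralForms Φ 2))) +
        finrank ℤ ↥(B₄.orthogonal L₄ ⊓ AddSubgroup.toIntSubmodule ((integralHodgeClassesIn Φ 4 2).addSubgroupOf (integralForms Φ 4))) ∧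
    sigPos (((orientationSign Φ e * (-1) ^ q) • B₄).restrict (AddSubgroup.toIntSubmodule ((integralHodgeClassesIn Φ 4 2).addSubgroupOf (integralForms Φ 4)))).toQuadraticMap =
      1 + finrank ℤ ↥(B₄.orthogonal L₄ ⊓ AddSubgroup.toIntSubmodule ((integralHodgeClassesIn Φ 4 2).addSubgroupOf (integralForms Φ 4))) ∧
    sigNeg (((orientationSign Φ e * (-1) ^ q) • B₄).restrict (AddSubgroup.toIntSubmodule ((integralHodgeClassesIn Φ 4 2).addSubgroupOf (integralForms Φ 4)))).toQuadraticMap =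
      finrank ℤ ↥(B₂.orthogonal L₂ ⊓ AddSubgroup.toIntSubmodule ((integralHodgeClassesIn Φ 2 1).addSubgroupOf (integralForms Φ 2))) := by
  obtain ⟨hM'n, -, hP2, hN2⟩ := hd.hodgeIndex_integralHodgeClassesIn_two_one hη hq2 hγ' hq4 hγ'' e hn₂ hn₀ hB₂ hB₀ hL₂
  obtain ⟨hMn, hrk, heven, -⟩ := hd.integralHodge_lattice_lefschetz_step (p := 1) hη (by omega) hq hγ hq2 hγ' e hn hn₂ hB₄ hB₂ hL₄
    (mem_toIntSubmodule_integralHodgeClassesIn_iff Φ rfl) (mem_toIntSubmodule_integralHodgeClassesIn_iff Φ rfl) hM'n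
  obtain ⟨hP, hN⟩ := heven ⟨1, rfl⟩
  exact ⟨hMn, hrk, hP.trans (congrArg (· + finrank ℤ ↥(B₄.orthogonal L₄ ⊓ AddSubgroup.toIntSubmodule ((integralHodgeClassesIn Φ 4 2).addSubgroupOf (integralForms Φ 4)))) hP2),
    hN.trans hN2⟩

end Consequences

end Literature.Geometry.Kaehler.ComplexTorus
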